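import Literature.MathematicalPhysics.QuantumLattice.FinDimSpectrumProofs
import Literature.MathematicalPhysics.QuantumLattice.ApproximatingHamiltonianProofs
import Literature.MathematicalPhysics.QuantumLattice.LiebRobinsonHastingsKomaSpectralProofs
import Literature.MathematicalPhysics.QuantumLattice.LiebFluxPhaseProofs
import HarnessLib

/-!
# Crux `CwThesis` (stmt-HubbardSuperconductivity-10438, route `ChiralWindow`), line
`SketchIdeator2` (card `participation-chebyshev-ring`) — stub `stub_participationChebyshev`

**Participation-number Chebyshev inequality** (the card's first lemma, purely finite-dimensional):
for Hermitian `H`, `X` on a finite index type `m`, `β > 0`, a real centre `c` and every normalised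
ground-state vector `ψ` of `H` (`H ψ = E₀ ψ`, `E₀ = Matrix.groundEnergy H`),

`c - √( Re tr((X - c)(X - c) e^{-βH}) · Re Z(β) / Re Z(2β) ) ≤ Re ⟨ψ, X ψ⟩`,

where `e^{-βH} = Matrix.gibbsWeight β H` and `Z = Matrix.partitionFn`.

Proof: with `D = X - c` and `P = |ψ⟩⟨ψ|`,
* `(c - Re⟨ψ,Xψ⟩)² = (Re⟨ψ,Dψ⟩)² ≤ ‖Dψ‖² = Re⟨ψ,D²ψ⟩` (Cauchy–Schwarz);
* `e^{-βH} ψ = e^{-βE₀} ψ` (`exp_smul_mulVec_of_mulVec_eq`), so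
  `e^{-βH} - e^{-βE₀} P = (1-P) e^{-βH} (1-P)` is positive semidefinite, whence
  `e^{-βE₀} Re⟨ψ,D²ψ⟩ ≤ Re tr(D² e^{-βH})` (trace of the positive semidefinite
  `D (e^{-βH} - e^{-βE₀} P) D`, cyclicity of the trace);
* `Re Z(2β) = Σ e^{-2βλᵢ} ≤ e^{-βE₀} Σ e^{-βλᵢ} = e^{-βE₀} Re Z(β)` (`partitionFn_eq_sum_exp`,
  `groundEnergy_le_eigenvalues`);
combine (`Re Z(β), Re Z(2β) > 0` on the nonempty index type carrying the unit vector `ψ`) and take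
square roots.

No definition is introduced. [folklore]
-/

noncomputable section

set_option linter.dupNamespace false

namespace Summit.HubbardSuperconductivity.HubbardSuperconductivity.Theorems.CwThesis

open Matrix Literature.MathematicalPhysics.QuantumLattice
open scoped ComplexOrder

/-- **Cauchy–Schwarz** for the standard Hermitian form on `m → ℂ`, squared:
`|⟨u, v⟩|² ≤ Re⟨u,u⟩ · Re⟨v,v⟩` (through `EuclideanSpace ℂ m`). [folklore] -/
private theorem norm_star_dotProduct_sq_le {m : Type*} [Fintype m] (u v : m → ℂ) :
    ‖star u ⬝ᵥ v‖ ^ 2 ≤ (star u ⬝ᵥ u).re * (star v ⬝ᵥ v).re := by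
  have h := norm_inner_le_norm (𝕜 := ℂ) (WithLp.toLp 2 u : EuclideanSpace ℂ m) (WithLp.toLp 2 v)
  rw [EuclideanSpace.inner_toLp_toLp, dotProduct_comm] at h
  have hu : ‖(WithLp.toLp 2 u : EuclideanSpace ℂ m)‖ ^ 2 = (star u ⬝ᵥ u).re := by
    rw [← inner_self_eq_norm_sq (𝕜 := ℂ), EuclideanSpace.inner_toLp_toLp, dotProduct_comm,
      RCLike.re_to_complex]
  have hv : ‖(WithLp.toLp 2 v : EuclideanSpace ℂ m)‖ ^ 2 = (star v ⬝ᵥ v).re := by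
    rw [← inner_self_eq_norm_sq (𝕜 := ℂ), EuclideanSpace.inner_toLp_toLp, dotProduct_comm,
      RCLike.re_to_complex]
  calc ‖star u ⬝ᵥ v‖ ^ 2
      ≤ (‖(WithLp.toLp 2 u : EuclideanSpace ℂ m)‖ * ‖(WithLp.toLp 2 v : EuclideanSpace ℂ m)‖) ^ 2 :=
        pow_le_pow_left₀ (norm_nonneg _) h 2
    _ = (star u ⬝ᵥ u).re * (star v ⬝ᵥ v).re := by rw [mul_pow, hu, hv]

/-- **Jensen / Cauchy–Schwarz for a Hermitian observable in a unit vector**: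
`(Re⟨ψ, Dψ⟩)² ≤ Re⟨ψ, D²ψ⟩ = ‖Dψ‖²` for Hermitian `D` and `‖ψ‖ = 1`. [folklore] -/
private theorem re_sq_le_re_dotProduct_mul_self {m : Type*} [Fintype m] {D : Matrix m m ℂ}
    (hD : D.IsHermitian) {ψ : m → ℂ} (hψ : star ψ ⬝ᵥ ψ = 1) :
    (star ψ ⬝ᵥ D *ᵥ ψ).re ^ 2 ≤ (star ψ ⬝ᵥ (D * D) *ᵥ ψ).re := by
  have hR : star (D *ᵥ ψ) ⬝ᵥ (D *ᵥ ψ) = star ψ ⬝ᵥ (D * D) *ᵥ ψ := by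
    rw [star_mulVec, hD.eq, ← dotProduct_mulVec, mulVec_mulVec]
  have hcs := norm_star_dotProduct_sq_le ψ (D *ᵥ ψ)
  rw [hψ, Complex.one_re, one_mul, hR] at hcs
  have hre : (star ψ ⬝ᵥ D *ᵥ ψ).re ^ 2 ≤ ‖star ψ ⬝ᵥ D *ᵥ ψ‖ ^ 2 := by
    rw [Complex.sq_norm, Complex.normSq_apply]
    nlinarith [sq_nonneg (star ψ ⬝ᵥ D *ᵥ ψ).im]
  exact hre.trans hcs

/-- **A positive semidefinite matrix dominates its eigen-projector term**: if `A ⪰ 0`,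
`‖ψ‖ = 1` and `A ψ = r ψ` (`r` real), then `A - r |ψ⟩⟨ψ| ⪰ 0`; indeed
`A - r|ψ⟩⟨ψ| = (1 - |ψ⟩⟨ψ|) A (1 - |ψ⟩⟨ψ|)`. [folklore] -/
private theorem posSemidef_sub_smul_vecMulVec {m : Type*} [Fintype m] [DecidableEq m]
    {A : Matrix m m ℂ} (hA : A.PosSemidef) {ψ : m → ℂ} {r : ℝ} (hψ : star ψ ⬝ᵥ ψ = 1)
    (hAψ : A *ᵥ ψ = (r : ℂ) • ψ) :
    (A - (r : ℂ) • vecMulVec ψ (star ψ)).PosSemidef := by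
  have hψA : star ψ ᵥ* A = (r : ℂ) • star ψ := by
    have h : star (A *ᵥ ψ) = star ψ ᵥ* A := by rw [star_mulVec, hA.1.eq]
    rw [← h, hAψ, star_smul, Complex.star_def, Complex.conj_ofReal]
  have hPA : vecMulVec ψ (star ψ) * A = (r : ℂ) • vecMulVec ψ (star ψ) := by
    rw [vecMulVec_mul, hψA, vecMulVec_smul]
  have hAP : A * vecMulVec ψ (star ψ) = (r : ℂ) • vecMulVec ψ (star ψ) := by
    rw [mul_vecMulVec, hAψ, smul_vecMulVec]
  have hPP : vecMulVec ψ (star ψ) * vecMulVec ψ (star ψ) = vecMulVec ψ (star ψ) := by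
    rw [vecMulVec_mul_vecMulVec, hψ, one_smul]
  have hPh : (vecMulVec ψ (star ψ))ᴴ = vecMulVec ψ (star ψ) := by
    rw [conjTranspose_vecMulVec, star_star]
  have key : (1 - vecMulVec ψ (star ψ))ᴴ * A * (1 - vecMulVec ψ (star ψ)) =
      A - (r : ℂ) • vecMulVec ψ (star ψ) := by
    rw [conjTranspose_sub, conjTranspose_one, hPh, Matrix.sub_mul, Matrix.one_mul, hPA,
      Matrix.mul_sub, Matrix.mul_one, Matrix.sub_mul, hAP, Matrix.smul_mul, hPP, sub_self,
      sub_zero]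
  rw [← key]
  exact hA.conjTranspose_mul_mul_same _

/-- **Ground-vector term of a thermal trace**: if `A ⪰ 0`, `D` is Hermitian, `‖ψ‖ = 1` and
`A ψ = r ψ` (`r` real), then `r · Re⟨ψ, D²ψ⟩ ≤ Re tr(D² A)` (trace of the positive semidefinite
`D (A - r|ψ⟩⟨ψ|) D` and cyclicity). [folklore] -/
private theorem mul_re_dotProduct_le_re_trace {m : Type*} [Fintype m] [DecidableEq m]
    {A D : Matrix m m ℂ} (hA : A.PosSemidef) (hD : D.IsHermitian) {ψ : m → ℂ} {r : ℝ}
    (hψ : star ψ ⬝ᵥ ψ = 1) (hAψ : A *ᵥ ψ = (r : ℂ) • ψ) :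
    r * (star ψ ⬝ᵥ (D * D) *ᵥ ψ).re ≤ (D * D * A).trace.re := by
  have hDMD := (posSemidef_sub_smul_vecMulVec hA hψ hAψ).conjTranspose_mul_mul_same D
  rw [hD.eq] at hDMD
  have htr := hDMD.trace_nonneg
  rw [Matrix.mul_sub, Matrix.sub_mul, trace_sub, Matrix.mul_smul, Matrix.smul_mul, trace_smul,
    trace_mul_cycle D A D, trace_mul_cycle D (vecMulVec ψ (star ψ)) D, mul_vecMulVec,
    trace_vecMulVec, dotProduct_comm, smul_eq_mul] at htr
  obtain ⟨h2, -⟩ := Complex.nonneg_iff.mp htr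
  rwa [Complex.sub_re, Complex.re_ofReal_mul, sub_nonneg] at h2

/-- **Participation bound on the doubled temperature**: `Re Z(2β) ≤ e^{-βE₀} · Re Z(β)` for a
Hermitian `H` and `β ≥ 0` (`e^{-2βλ} ≤ e^{-βE₀} e^{-βλ}` termwise in `Z = Σ e^{-βλᵢ}`,
`E₀ ≤ λᵢ`). [folklore] -/
private theorem re_partitionFn_two_mul_le {m : Type*} [Fintype m] [DecidableEq m]
    {H : Matrix m m ℂ} (hH : H.IsHermitian) {β : ℝ} (hβ : 0 ≤ β) :
    (Matrix.partitionFn (2 * β) H).re ≤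
      Real.exp (-(β * H.groundEnergy)) * (Matrix.partitionFn β H).re := by
  rw [hH.partitionFn_eq_ofReal, hH.partitionFn_eq_ofReal, Complex.ofReal_re, Complex.ofReal_re,
    Finset.mul_sum]
  refine Finset.sum_le_sum fun i _ => ?_
  have hi : H.groundEnergy ≤ hH.eigenvalues i := groundEnergy_le_eigenvalues hH i
  rw [← Real.exp_add]
  exact Real.exp_le_exp.2 (by nlinarith [mul_le_mul_of_nonneg_left hi hβ])

/-- **Participation-number Chebyshev.** For Hermitian `H`, `X` on a finite index type, `β > 0`, a
real centre `c` and every normalised ground-state vector `ψ` of `H` (`H ψ = E₀ ψ`,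
`E₀ = groundEnergy H`):
`c - √( Re tr((X - c)·(X - c)·e^{-βH}) · Re Z(β) / Re Z(2β) ) ≤ Re ⟨ψ, X ψ⟩`.
Proof: `(c - Re⟨ψ,Xψ⟩)² ≤ ⟨ψ,(X-c)²ψ⟩` (Cauchy–Schwarz);
`e^{-βH} - e^{-βE₀}|ψ⟩⟨ψ| ⪰ 0` (ψ is an eigenvector of `e^{-βH}` for `e^{-βE₀}`,
`exp_smul_mulVec_of_mulVec_eq`), so `e^{-βE₀}⟨ψ,(X-c)²ψ⟩ ≤ Re tr((X-c)² e^{-βH})`; and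
`Re Z(2β) = Σ e^{-2βEᵢ} ≤ e^{-βE₀} Σ e^{-βEᵢ} = e^{-βE₀} Re Z(β)` (`partitionFn_eq_sum_exp`,
`groundEnergy_le_eigenvalues`); combine and take square roots. [folklore] -/
theorem stub_participationChebyshev {m : Type*} [Fintype m] [DecidableEq m]
    (H X : Matrix m m ℂ) (hH : H.IsHermitian) (hX : X.IsHermitian) {β : ℝ} (hβ : 0 < β) (c : ℝ)
    (ψ : m → ℂ) (hψ : star ψ ⬝ᵥ ψ = 1) (hHψ : H *ᵥ ψ = ((H.groundEnergy : ℝ) : ℂ) • ψ) :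
    c - Real.sqrt (((X - (c : ℂ) • 1) * (X - (c : ℂ) • 1) * Matrix.gibbsWeight β H).trace.re *
        (Matrix.partitionFn β H).re / (Matrix.partitionFn (2 * β) H).re) ≤
      (star ψ ⬝ᵥ X *ᵥ ψ).re := by
  -- the index type is nonempty since `ψ` is a unit vector
  rcases isEmpty_or_nonempty m with hm | hm
  · exfalso
    have : star ψ ⬝ᵥ ψ = 0 := by simp [dotProduct]
    rw [this] at hψ
    exact zero_ne_one hψ
  have hDh : (X - (c : ℂ) • 1).IsHermitian :=
    hX.sub (IsHermitian.smul Matrix.isHermitian_one (Complex.conj_ofReal c))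
  -- (i) Cauchy–Schwarz: `(c - Re⟨ψ,Xψ⟩)² ≤ Re⟨ψ, (X-c)² ψ⟩`
  have ht : star ψ ⬝ᵥ (X - (c : ℂ) • 1) *ᵥ ψ = star ψ ⬝ᵥ X *ᵥ ψ - c := by
    rw [sub_mulVec, smul_mulVec, one_mulVec, dotProduct_sub, dotProduct_smul, hψ, smul_eq_mul,
      mul_one]
  have h1 : (c - (star ψ ⬝ᵥ X *ᵥ ψ).re) ^ 2 ≤
      (star ψ ⬝ᵥ ((X - (c : ℂ) • 1) * (X - (c : ℂ) • 1)) *ᵥ ψ).re := by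
    have h := re_sq_le_re_dotProduct_mul_self hDh hψ
    rw [ht, Complex.sub_re, Complex.ofReal_re] at h
    calc (c - (star ψ ⬝ᵥ X *ᵥ ψ).re) ^ 2 = ((star ψ ⬝ᵥ X *ᵥ ψ).re - c) ^ 2 := by ring
      _ ≤ _ := h
  -- (ii) `e^{-βE₀} Re⟨ψ, (X-c)² ψ⟩ ≤ Re tr((X-c)² e^{-βH})`
  have hGψ : Matrix.gibbsWeight β H *ᵥ ψ = ((Real.exp (-(β * H.groundEnergy)) : ℝ) : ℂ) • ψ := by
    rw [Matrix.gibbsWeight, exp_smul_mulVec_of_mulVec_eq H hHψ (-(β : ℂ))]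
    congr 1
    rw [Complex.ofReal_exp]
    push_cast
    ring_nf
  have h2 := mul_re_dotProduct_le_re_trace (posDef_gibbsWeight β hH).posSemidef hDh hψ hGψ
  -- (iii) `Re Z(2β) ≤ e^{-βE₀} Re Z(β)`
  have h3 := re_partitionFn_two_mul_le hH hβ.le
  -- (iv) positivity of the partition functions
  have hZ1 : 0 < (Matrix.partitionFn β H).re := partitionFn_re_pos hH β
  have hZ2 : 0 < (Matrix.partitionFn (2 * β) H).re := partitionFn_re_pos hH (2 * β)
  -- combine: `(c - Re⟨ψ,Xψ⟩)² ≤ T · Z(β) / Z(2β)`, then take square roots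
  have hsq : (c - (star ψ ⬝ᵥ X *ᵥ ψ).re) ^ 2 ≤
      ((X - (c : ℂ) • 1) * (X - (c : ℂ) • 1) * Matrix.gibbsWeight β H).trace.re *
        (Matrix.partitionFn β H).re / (Matrix.partitionFn (2 * β) H).re := by
    rw [le_div_iff₀ hZ2]
    have hRnn : 0 ≤ (star ψ ⬝ᵥ ((X - (c : ℂ) • 1) * (X - (c : ℂ) • 1)) *ᵥ ψ).re :=
      (sq_nonneg _).trans h1
    calc (c - (star ψ ⬝ᵥ X *ᵥ ψ).re) ^ 2 * (Matrix.partitionFn (2 * β) H).re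
        ≤ (star ψ ⬝ᵥ ((X - (c : ℂ) • 1) * (X - (c : ℂ) • 1)) *ᵥ ψ).re *
            (Real.exp (-(β * H.groundEnergy)) * (Matrix.partitionFn β H).re) :=
          mul_le_mul h1 h3 hZ2.le hRnn
      _ = Real.exp (-(β * H.groundEnergy)) *
            (star ψ ⬝ᵥ ((X - (c : ℂ) • 1) * (X - (c : ℂ) • 1)) *ᵥ ψ).re *
            (Matrix.partitionFn β H).re := by ring
      _ ≤ ((X - (c : ℂ) • 1) * (X - (c : ℂ) • 1) * Matrix.gibbsWeight β H).trace.re *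
            (Matrix.partitionFn β H).re :=
          mul_le_mul_of_nonneg_right h2 hZ1.le
  have hfin := (le_abs_self _).trans (Real.abs_le_sqrt hsq)
  linarith
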